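import Literature.NumberTheory.QuadraticForms.HilbertSymbolBilinear
import Literature.NumberTheory.QuadraticForms.HilbertSymbolNonDyadic
import HarnessLib

/-!
# Numbers represented by binary and ternary forms over a local field (Serre IV §2.2)

Topic `NumberTheory/QuadraticForms`; namespace `Literature.NumberTheory.QuadraticForms`. Everything
here is proved.

Let `K` be a number field, `v` a finite place (dyadic places included) and `K_v` the completion.
Serre (*A Course in Arithmetic*, Ch. IV §2.2, Thm. 6 and its Corollary) determines which
`x ∈ K_vˣ` are represented by a non-degenerate quadratic form of rank `n` over `K_v` in terms of
the discriminant `d` and the Hasse invariant `ε`. We prove the three consequences that drive the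
proofs of the Hasse–Minkowski theorem in ranks `4` and `≥ 5` (Ch. IV §3.2 Thm. 8 (iii), (iv)),
phrased for diagonal forms and Hilbert symbols `(a, b)_v` (`hilbertSymbol`, O'Meara §63B):

* `exists_binary_eq_iff_hilbertSymbol` — **rank 2** (Cor. to Thm. 6, (i)): for `a b x ∈ K_vˣ`,
  `⟨a, b⟩` represents `x` iff `(x, -ab)_v = (a, b)_v`. (Over any field: iff `(ax, bx) = 1`;
  the passage to `(x, -ab)(a, b)` is the bimultiplicativity of the local symbol,
  `HilbertSymbolBilinear.lean`.)
* `exists_ternary_eq_of_not_isSquare` — **rank 3** (Cor. to Thm. 6, (ii)): `⟨a, b, c⟩`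
  represents every `x ∈ K_vˣ` outside the square class of `-abc`. Proof as in Serre's proof of
  Thm. 6 for `n = 4`: `x` is represented iff some `t` is represented by both `⟨a, b⟩` and
  `⟨x, -c⟩`, i.e. `(t, -ab) = (a, b)` and `(t, cx) = (x, -c)`; when `-ab` and `cx` have distinct
  square classes the two characters `(·, -ab)_v ≠ (·, cx)_v` (non-degeneracy of the Hilbert
  pairing, O'Meara 63:13) take all four pairs of values jointly.
* over any field with `2 ≠ 0`: isotropic binary and ternary diagonal forms are universal
  (§1.6 Prop. 3', §1.7 Prop. 4).

The sequel `HilbertSymbolLocalQuinary.lean` adds Thm. 6 (iv) (rank `5` is isotropic over `K_v`).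
Not here: the full statement of Thm. 6 (the invariants `d`, `ε` of a general form), Thm. 7
(classification), the real place (signs).

## References

* J.-P. Serre, *A Course in Arithmetic*, GTM 7, Springer 1973, Ch. IV §2.2 Thm. 6 and Corollary,
  §1.6–1.7 (isotropic forms are universal) (PDF pp. 36–38). [Serre1973]
* O. T. O'Meara, *Introduction to quadratic forms* (1963), §63B (63:13), §63A (63:9).
-/

noncomputable section

open IsDedekindDomain NumberField
open scoped Valued

namespace Literature.NumberTheory.QuadraticForms

/-! ### Over an arbitrary field of characteristic `≠ 2` -/

section Field

variable {F : Type*} [Field F]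

/-- `⟨a, b⟩` represents `x ≠ 0` iff `(ax, bx)_F = 1`: dividing `a y² + b z² = x` by `x` gives
`(a/x) y² + (b/x) z² = 1`, and `a/x ≡ ax` modulo squares. [cite: Serre1973, Ch. IV §2.2 Cor. to Thm. 6] -/
theorem exists_binary_eq_iff_hilbertSymbol_mul {a b x : F} (hx : x ≠ 0) :
    (∃ y z : F, a * y ^ 2 + b * z ^ 2 = x) ↔ hilbertSymbol F (a * x) (b * x) = 1 := by
  have hax : a * x = a * x⁻¹ * x ^ 2 := by field_simp
  have hbx : b * x = b * x⁻¹ * x ^ 2 := by field_simp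
  rw [hax, hilbertSymbol_mul_sq_left _ _ hx, hbx, hilbertSymbol_mul_sq_right _ _ hx,
    hilbertSymbol_eq_one_iff]
  constructor
  · rintro ⟨y, z, h⟩
    exact ⟨y, z, by rw [← mul_inv_cancel₀ hx, ← h]; ring⟩
  · rintro ⟨y, z, h⟩
    exact ⟨y, z, by rw [← mul_inv_cancel₀ hx] at h; field_simp at h; linear_combination h⟩

/-- **An isotropic binary form is universal** (`2 ≠ 0`): if `a y₀² + b z₀² = 0` with
`(y₀, z₀) ≠ 0` and `a b ≠ 0`, then `⟨a, b⟩` represents every `x` (Serre IV §1.7 Prop. 4 / §1.6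
Prop. 3': a hyperbolic plane represents everything; here `g(q + s p) = g(q) + 2 s B(p, q)` for the
isotropic `p` and `q = (1, 0)`). [cite: Serre1973, Ch. IV §1.6 Prop. 3'] -/
theorem exists_binary_eq_of_zero [NeZero (2 : F)] {a b y₀ z₀ : F} (ha : a ≠ 0) (hb : b ≠ 0)
    (h0 : a * y₀ ^ 2 + b * z₀ ^ 2 = 0) (hne : y₀ ≠ 0 ∨ z₀ ≠ 0) (x : F) :
    ∃ y z : F, a * y ^ 2 + b * z ^ 2 = x := by
  have h2 : (2 : F) ≠ 0 := two_ne_zero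
  have hy₀ : y₀ ≠ 0 := by
    rcases hne with h | h
    · exact h
    · rintro rfl
      apply h
      have : b * z₀ ^ 2 = 0 := by linear_combination h0
      simpa [hb] using this
  -- `B(p, q) = a y₀` for `q = (1, 0)`; `g(q + s p) = a + 2 s a y₀`
  set s : F := (x - a) / (2 * a * y₀) with hs
  refine ⟨1 + s * y₀, s * z₀, ?_⟩
  have hB : a * y₀ ≠ 0 := mul_ne_zero ha hy₀
  have key : a * (1 + s * y₀) ^ 2 + b * (s * z₀) ^ 2 = a + 2 * s * (a * y₀) := by
    linear_combination s ^ 2 * h0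
  rw [key, hs]
  field_simp
  ring

/-- **An isotropic ternary form is universal** (`2 ≠ 0`): if `a p₁² + b p₂² + c p₃² = 0` with
`p ≠ 0` and `a b c ≠ 0`, then `⟨a, b, c⟩` represents every `x` (Serre IV §1.6 Prop. 3', §1.7
Prop. 4: `g(q + s p) = g(q) + 2 s B(p, q)` with `q` a coordinate vector not orthogonal to `p`).
[cite: Serre1973, Ch. IV §1.6 Prop. 3'] -/
theorem exists_ternary_eq_of_zero [NeZero (2 : F)] {a b c p₁ p₂ p₃ : F} (ha : a ≠ 0)
    (hb : b ≠ 0) (hc : c ≠ 0) (h0 : a * p₁ ^ 2 + b * p₂ ^ 2 + c * p₃ ^ 2 = 0)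
    (hne : p₁ ≠ 0 ∨ p₂ ≠ 0 ∨ p₃ ≠ 0) (x : F) :
    ∃ y z w : F, a * y ^ 2 + b * z ^ 2 + c * w ^ 2 = x := by
  have h2 : (2 : F) ≠ 0 := two_ne_zero
  -- reduce to the case `p₁ ≠ 0` by permuting the variables
  suffices key : ∀ {a b c p₁ p₂ p₃ : F}, a ≠ 0 → a * p₁ ^ 2 + b * p₂ ^ 2 + c * p₃ ^ 2 = 0 →
      p₁ ≠ 0 → ∀ x : F, ∃ y z w : F, a * y ^ 2 + b * z ^ 2 + c * w ^ 2 = x by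
    rcases hne with h | h | h
    · exact key ha h0 h x
    · obtain ⟨y, z, w, hyzw⟩ := key (a := b) (b := c) (c := a) (p₁ := p₂) (p₂ := p₃) (p₃ := p₁)
        hb (by linear_combination h0) h x
      exact ⟨w, y, z, by linear_combination hyzw⟩
    · obtain ⟨y, z, w, hyzw⟩ := key (a := c) (b := a) (c := b) (p₁ := p₃) (p₂ := p₁) (p₃ := p₂)
        hc (by linear_combination h0) h x
      exact ⟨z, w, y, by linear_combination hyzw⟩
  intro a b c p₁ p₂ p₃ ha h0 hp₁ x
  set s : F := (x - a) / (2 * a * p₁) with hs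
  refine ⟨1 + s * p₁, s * p₂, s * p₃, ?_⟩
  have hB : a * p₁ ≠ 0 := mul_ne_zero ha hp₁
  have key : a * (1 + s * p₁) ^ 2 + b * (s * p₂) ^ 2 + c * (s * p₃) ^ 2 =
      a + 2 * s * (a * p₁) := by
    linear_combination s ^ 2 * h0
  rw [key, hs]
  field_simp
  ring

end Field

/-! ### Over the completion `K_v` of a number field at a finite place -/

section Local

variable (K : Type) [Field K] [NumberField K] (v : HeightOneSpectrum (𝓞 K))

/-- `NeZero 2` in `K_v` (characteristic `0`), for local use with `haveI`. [folklore] -/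
theorem neZero_two_adicCompletion : NeZero (2 : v.adicCompletion K) := by
  haveI : CharZero (v.adicCompletion K) :=
    charZero_of_injective_algebraMap (algebraMap K _).injective
  exact ⟨two_ne_zero⟩

/-- `(x, x)_v = (x, -1)_v` and bimultiplicativity give
`(ax, bx)_v = (a, b)_v · (x, -ab)_v` for `a b x ∈ K_vˣ` (Serre IV §2.2, proof of the Corollary
to Thm. 6: "`x` is represented by `⟨a, b⟩` iff `(x, -ab) = (a, b)`").
[cite: Serre1973, Ch. IV §2.2 Cor. to Thm. 6] -/
theorem hilbertSymbol_mul_mul_eq {a b x : v.adicCompletion K} (ha : a ≠ 0) (hb : b ≠ 0)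
    (hx : x ≠ 0) :
    hilbertSymbol (v.adicCompletion K) (a * x) (b * x) =
      hilbertSymbol (v.adicCompletion K) a b * hilbertSymbol (v.adicCompletion K) x (-(a * b)) := by
  haveI := neZero_two_adicCompletion K v
  have hbx : b * x ≠ 0 := mul_ne_zero hb hx
  have hn1 : (-1 : v.adicCompletion K) ≠ 0 := neg_ne_zero.2 one_ne_zero
  rw [hilbertSymbol_adicCompletion_mul_left K v ha hx hbx,
    hilbertSymbol_adicCompletion_mul_right K v hb hx ha,
    hilbertSymbol_adicCompletion_mul_right K v hb hx hx,
    show -(a * b) = (-1) * a * b by ring,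
    hilbertSymbol_adicCompletion_mul_right K v (mul_ne_zero hn1 ha) hb hx,
    hilbertSymbol_adicCompletion_mul_right K v hn1 ha hx,
    ← hilbertSymbol_self_right hx, hilbertSymbol_comm x a]
  -- both sides are products of `±1`'s
  rcases hilbertSymbol_eq_one_or_eq_neg_one a b with h1 | h1 <;>
  rcases hilbertSymbol_eq_one_or_eq_neg_one a x with h2 | h2 <;>
  rcases hilbertSymbol_eq_one_or_eq_neg_one x b with h3 | h3 <;>
  rcases hilbertSymbol_eq_one_or_eq_neg_one x x with h4 | h4 <;>
  simp [h1, h2, h3, h4]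

/-- **Numbers represented by a binary form over `K_v`** (Serre IV §2.2 Cor. to Thm. 6, (i)): for
`a b x ∈ K_vˣ`, `x` is represented by `⟨a, b⟩` iff `(x, -ab)_v = (a, b)_v`.
[cite: Serre1973, Ch. IV §2.2 Cor. to Thm. 6] -/
theorem exists_binary_eq_iff_hilbertSymbol {a b x : v.adicCompletion K} (ha : a ≠ 0)
    (hb : b ≠ 0) (hx : x ≠ 0) :
    (∃ y z : v.adicCompletion K, a * y ^ 2 + b * z ^ 2 = x) ↔
      hilbertSymbol (v.adicCompletion K) x (-(a * b)) = hilbertSymbol (v.adicCompletion K) a b := by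
  rw [exists_binary_eq_iff_hilbertSymbol_mul hx, hilbertSymbol_mul_mul_eq K v ha hb hx]
  rcases hilbertSymbol_eq_one_or_eq_neg_one a b with h1 | h1 <;>
  rcases hilbertSymbol_eq_one_or_eq_neg_one x (-(a * b)) with h2 | h2 <;>
  simp [h1, h2]

/-- **Non-degeneracy of the Hilbert pairing** (O'Meara 63:13, proved in `LocalNormIndex.lean`):
for a non-square `c ∈ K_vˣ` some `t ∈ K_vˣ` has `(t, c)_v = -1`. [cite: Omeara1963, §63B Prop. 63:13] -/
theorem exists_hilbertSymbol_eq_neg_one_left {c : v.adicCompletion K} (hc : c ≠ 0)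
    (hcs : ¬ IsSquare c) : ∃ t : v.adicCompletion K, t ≠ 0 ∧
      hilbertSymbol (v.adicCompletion K) t c = -1 :=
  adicCompletion_exists_hilbertSymbol_eq_neg_one_holds K v c hc hcs

/-- **Two distinct characters `(·, u₁)_v ≠ (·, u₂)_v` take all pairs of values jointly**: if
`u₁ u₂` is not a square (so that some `t₀` has `(t₀, u₁)_v ≠ (t₀, u₂)_v`), then for any
`a, x ∈ K_vˣ` there is `t ∈ K_vˣ` with `(t, u₁)_v = (a, u₁)_v` and `(t, u₂)_v = (x, u₂)_v` — one of
`a, x, 1, ax, t₀, ax t₀` works. This is the counting step in Serre's proof of Thm. 6 for `n = 4`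
("`A` and `B` are non-empty … `A ∩ B ≠ ∅`"). [cite: Serre1973, Ch. IV §2.2 Thm. 6 (proof, n = 4)] -/
theorem exists_hilbertSymbol_eq_and_eq {u₁ u₂ a x : v.adicCompletion K} (hu₁ : u₁ ≠ 0)
    (hu₂ : u₂ ≠ 0) (ha : a ≠ 0) (hx : x ≠ 0) (h : ¬ IsSquare (u₁ * u₂)) :
    ∃ t : v.adicCompletion K, t ≠ 0 ∧
      hilbertSymbol (v.adicCompletion K) t u₁ = hilbertSymbol (v.adicCompletion K) a u₁ ∧
      hilbertSymbol (v.adicCompletion K) t u₂ = hilbertSymbol (v.adicCompletion K) x u₂ := by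
  obtain ⟨t₀, ht₀, ht₀s⟩ := exists_hilbertSymbol_eq_neg_one_left K v (mul_ne_zero hu₁ hu₂) h
  -- `(t₀, u₁) (t₀, u₂) = -1`
  rw [hilbertSymbol_adicCompletion_mul_right K v hu₁ hu₂ ht₀] at ht₀s
  by_cases h1 : hilbertSymbol (v.adicCompletion K) x u₁ = hilbertSymbol (v.adicCompletion K) a u₁
  · exact ⟨x, hx, h1, rfl⟩
  by_cases h2 : hilbertSymbol (v.adicCompletion K) a u₂ = hilbertSymbol (v.adicCompletion K) x u₂
  · exact ⟨a, ha, rfl, h2⟩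
  -- `ax ↦ (-1, -1)`
  have hax1 : hilbertSymbol (v.adicCompletion K) (a * x) u₁ = -1 := by
    rw [hilbertSymbol_adicCompletion_mul_left K v ha hx hu₁]
    rcases hilbertSymbol_eq_one_or_eq_neg_one a u₁ with h3 | h3 <;>
    rcases hilbertSymbol_eq_one_or_eq_neg_one x u₁ with h4 | h4 <;> simp_all
  have hax2 : hilbertSymbol (v.adicCompletion K) (a * x) u₂ = -1 := by
    rw [hilbertSymbol_adicCompletion_mul_left K v ha hx hu₂]
    rcases hilbertSymbol_eq_one_or_eq_neg_one a u₂ with h3 | h3 <;>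
    rcases hilbertSymbol_eq_one_or_eq_neg_one x u₂ with h4 | h4 <;> simp_all
  have hax : a * x ≠ 0 := mul_ne_zero ha hx
  -- the targets `e₁ = (a, u₁)`, `e₂ = (x, u₂)`
  rcases hilbertSymbol_eq_one_or_eq_neg_one a u₁ with e1 | e1 <;>
  rcases hilbertSymbol_eq_one_or_eq_neg_one x u₂ with e2 | e2
  · exact ⟨1, one_ne_zero, by rw [e1, hilbertSymbol_one_left], by rw [e2, hilbertSymbol_one_left]⟩
  · -- target `(1, -1)`
    rcases hilbertSymbol_eq_one_or_eq_neg_one t₀ u₁ with p | p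
    · refine ⟨t₀, ht₀, by rw [e1, p], ?_⟩
      rw [p, one_mul] at ht₀s
      rw [e2, ht₀s]
    · refine ⟨a * x * t₀, mul_ne_zero hax ht₀, ?_, ?_⟩
      · rw [hilbertSymbol_adicCompletion_mul_left K v hax ht₀ hu₁, hax1, p, e1]; norm_num
      · rw [p] at ht₀s
        rw [hilbertSymbol_adicCompletion_mul_left K v hax ht₀ hu₂, hax2, e2]
        linarith [ht₀s]
  · -- target `(-1, 1)`
    rcases hilbertSymbol_eq_one_or_eq_neg_one t₀ u₁ with p | p
    · refine ⟨a * x * t₀, mul_ne_zero hax ht₀, ?_, ?_⟩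
      · rw [hilbertSymbol_adicCompletion_mul_left K v hax ht₀ hu₁, hax1, p, e1]; norm_num
      · rw [p, one_mul] at ht₀s
        rw [hilbertSymbol_adicCompletion_mul_left K v hax ht₀ hu₂, hax2, e2, ht₀s]; norm_num
    · refine ⟨t₀, ht₀, by rw [e1, p], ?_⟩
      rw [p] at ht₀s
      rw [e2]
      linarith [ht₀s]
  · exact ⟨a * x, hax, by rw [e1, hax1], by rw [e2, hax2]⟩

/-- **Numbers represented by a ternary form over `K_v`** (Serre IV §2.2 Cor. to Thm. 6, (ii), the
inclusion needed for Hasse–Minkowski): for `a b c x ∈ K_vˣ` with `x ∉ -abc · K_vˣ²`, the form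
`⟨a, b, c⟩` represents `x`. Proof (Serre's proof of Thm. 6, `n = 4`, for `⟨a, b, c, -x⟩`): find
`t` represented by `⟨a, b⟩` and by `⟨x, -c⟩` (`exists_hilbertSymbol_eq_and_eq` with the characters
`(·, -ab)`, `(·, cx)`, distinct since `-abcx ∉ K_v²`); then `a y² + b z² = t = x s² - c w²`, and
either `s ≠ 0` (divide by `s`) or `⟨a, b, c⟩` is isotropic, hence universal.
[cite: Serre1973, Ch. IV §2.2 Cor. to Thm. 6] -/
theorem exists_ternary_eq_of_not_isSquare {a b c x : v.adicCompletion K} (ha : a ≠ 0)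
    (hb : b ≠ 0) (hc : c ≠ 0) (hx : x ≠ 0) (hxs : ¬ IsSquare (-(a * b * c * x))) :
    ∃ y z w : v.adicCompletion K, a * y ^ 2 + b * z ^ 2 + c * w ^ 2 = x := by
  haveI := neZero_two_adicCompletion K v
  have hu₁ : (-(a * b) : v.adicCompletion K) ≠ 0 := neg_ne_zero.2 (mul_ne_zero ha hb)
  have hu₂ : (c * x : v.adicCompletion K) ≠ 0 := mul_ne_zero hc hx
  have hprod : ¬ IsSquare (-(a * b) * (c * x)) := by
    rwa [show -(a * b) * (c * x) = -(a * b * c * x) by ring]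
  obtain ⟨t, ht0, ht1, ht2⟩ := exists_hilbertSymbol_eq_and_eq K v hu₁ hu₂ ha hx hprod
  -- `⟨a, b⟩` represents `t`
  have hrep1 : ∃ y z : v.adicCompletion K, a * y ^ 2 + b * z ^ 2 = t := by
    rw [exists_binary_eq_iff_hilbertSymbol K v ha hb ht0, ht1]
    exact hilbertSymbol_neg_mul_right ha b
  -- `⟨x, -c⟩` represents `t`
  have hrep2 : ∃ s w : v.adicCompletion K, x * s ^ 2 + (-c) * w ^ 2 = t := by
    rw [exists_binary_eq_iff_hilbertSymbol K v hx (neg_ne_zero.2 hc) ht0,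
      show -(x * -c) = c * x by ring, ht2, ← hilbertSymbol_neg_mul_right hx (-c),
      show -(x * -c) = c * x by ring]
  obtain ⟨y, z, hyz⟩ := hrep1
  obtain ⟨s, w, hsw⟩ := hrep2
  by_cases hs : s = 0
  · -- `⟨a, b, c⟩` is isotropic: `a y² + b z² + c w² = 0`, `w ≠ 0`
    subst hs
    have hw : w ≠ 0 := by
      rintro rfl
      apply ht0
      linear_combination -hsw
    exact exists_ternary_eq_of_zero ha hb hc (p₁ := y) (p₂ := z) (p₃ := w)
      (by linear_combination hyz - hsw) (Or.inr (Or.inr hw)) x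
  · refine ⟨y / s, z / s, w / s, ?_⟩
    field_simp
    linear_combination hyz - hsw

end Local

end Literature.NumberTheory.QuadraticForms
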